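import Summits.AtomisticToContinuum.FouriersLaw.Theorems.BondHeatUncertaintyBoundedResponseBathHeatOctaveA
import HarnessLib

/-!
# BondHeatUncertainty / BoundedResponse — «Octave» §4–§6: ★★★ THE RESIDUAL DOOR `(S) ∧ (OR♭₁) ⟹ 11071`
(`boundedResponse_of_subdiffusiveBondHeat_lowOctaveReturnFloor`, via `(BHᵂ₁) ∧ (OR♭₁)`; also `(BHᵂ₁) ∧ (TL_{κ,1})`, `0 < κ ≤ 1`), its EXACTNESS
beneath (S) (`lowOctaveReturnFloor_of_boundedResponse_bathHeatWindow`, `boundedResponse_iff_lowOctaveReturnFloor_of_subdiffusiveBondHeat`), the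
necessity of (OR₁)/(TL_{κ,1}) given Ohm modulo (BTᶜ₁), and the kernel-level hub (TNM) `ThoulessNegMass ⟹ (OR₁)` fed by NODE 109's `LateNegMass a`
and NODE 117's `BandNegMass`
(decomp-a2c lens-1 g118, NODE 118 «Octave»; part 2 of 3; imports part A `…BathHeatOctaveA` (identity, statements, point door, window bound); the main
file `…BathHeatOctave` carries the late-window suppliers and the OVERVIEW docstring)

No `sorry`, no new axioms; every hypothesis of a door is one of the cell's docstring-tagged route statements or a tree statement.
-/

open MeasureTheory ProbabilityTheory Filter Topology Set Function
open scoped NNReal ENNReal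
open Literature.MathematicalPhysics.KineticTheory.HeatConduction
open Literature.MathematicalPhysics.KineticTheory OscillatorChain
open Literature.Probability.Process
open Summit.AtomisticToContinuum.FouriersLaw.Theorems.SubdiffusiveBondHeat
open Summit.AtomisticToContinuum.FouriersLaw.Theorems.SubdiffusiveBondHeat.EscapeGrading
open Summit.AtomisticToContinuum.FouriersLaw.Theorems.BoundedResponse.TransientBand
open Summit.AtomisticToContinuum.FouriersLaw.Theorems.BoundedResponse.ParityFloor

namespace Summit.AtomisticToContinuum.FouriersLaw.Theorems.BoundedResponse.HeatSpreading

open Summit.AtomisticToContinuum.FouriersLaw.Theorems.BoundedResponse.TransientContact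
open Summit.AtomisticToContinuum.FouriersLaw.Theses.BondHeatUncertainty (BoundedResponse SubdiffusiveBondHeat)

section Chain

variable {ω₂ lam β γ : ℝ} {T : ℝ}

/-! ## §4 Doors II: the window doors (BHᵂ₁) ∧ (TL_{κ,1}) and ★ (BHᵂ₁) ∧ (OR♭₁) -/

/-- ★★ **THE WINDOW DOOR: (BHᵂ₁) ∧ (TL_{κ,1}) ⟹ 11071 for every fraction `0 < κ ≤ 1`** — in `t·γT²E_N = 𝒲_N(t)/2 − B^early_N(s) − B^late_N(s,t)`
with `t = (c/2)N²`, `s = κt`: `𝒲_N(t) ≤ CN`, `−B^early_N(s) ≤ 𝒲_N(2s)/2 ≤ CN/2` (FREE: `2s ≤ cN²` lies in the window), `−B^late ≤ C′N`. [this cell] -/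
theorem boundedResponse_of_bathHeatWindow_thoulessLateFloor {κ : ℝ} (hκ : 0 < κ) (hκ1 : κ ≤ 1) (hW : BathHeatWindow 1)
    (hF : ThoulessLateFloor κ 1) : BoundedResponse := by
  refine ohmicFloor_iff_boundedResponse.1 fun ω₂ lam β γ hω hl hβ hγ T hT => ?_
  obtain ⟨C, c, hc, N₀, hCN⟩ := hW ω₂ lam β γ hω hl hβ hγ T hT
  obtain ⟨C', N₁, hC'⟩ := hF ω₂ lam β γ hω hl hβ hγ T hT (c / 2) (by positivity)
  refine ⟨(C + C') / (c / 2 * (γ * T ^ 2)), max N₀ (max N₁ 2), fun N hN => ?_⟩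
  have hNN₀ : N₀ ≤ N := le_trans (le_max_left _ _) hN
  have hNN₁ : N₁ ≤ N := le_trans (le_trans (le_max_left _ _) (le_max_right _ _)) hN
  have hN2 : 2 ≤ N := le_trans (le_trans (le_max_right _ _) (le_max_right _ _)) hN
  have hNpos : (0 : ℝ) < N := by exact_mod_cast (show 0 < N by omega)
  have hN2r : (0 : ℝ) ≤ (N : ℝ) ^ 2 := sq_nonneg _
  have ht0 : (0 : ℝ) ≤ c / 2 * (N : ℝ) ^ 2 := by positivity
  have hs0 : (0 : ℝ) ≤ κ * (c / 2 * (N : ℝ) ^ 2) := by positivity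
  have htc : c / 2 * (N : ℝ) ^ 2 ≤ c * (N : ℝ) ^ 2 := by nlinarith
  have h2sc : 2 * (κ * (c / 2 * (N : ℝ) ^ 2)) ≤ c * (N : ℝ) ^ 2 := by nlinarith [mul_nonneg hc.le hN2r]
  have hWt := hCN N hNN₀ _ ⟨ht0, htc⟩
  have hW2s := hCN N hNN₀ _ ⟨by positivity, h2sc⟩
  have hB := hC' N hNN₁
  rw [Real.rpow_one] at hWt hW2s hB
  have hid := mul_escapeDeficit_eq_half_bathHeatVar_sub hω hl hβ hγ hT (show 0 < N by omega) (κ * (c / 2 * (N : ℝ) ^ 2)) ht0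
  have hE := (bathTailEarly_mem_Icc hω hl hβ hγ hT (show 1 < N by omega) hs0).1
  have hcγ : 0 < c / 2 * (γ * T ^ 2) := by positivity
  rw [le_div_iff₀ hNpos, le_div_iff₀ hcγ]
  have h4 : (N : ℝ) * (escapeDeficit ω₂ lam β γ T N * N * (c / 2 * (γ * T ^ 2))) ≤ N * (C + C') := by
    have e : (N : ℝ) * (escapeDeficit ω₂ lam β γ T N * N * (c / 2 * (γ * T ^ 2))) =
        c / 2 * (N : ℝ) ^ 2 * (γ * T ^ 2 * escapeDeficit ω₂ lam β γ T N) := by ring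
    rw [e]
    nlinarith
  exact le_of_mul_le_mul_left h4 hNpos

/-- ★★ **BENEATH (S): (S) ∧ (TL_{κ,1}) ⟹ 11071 (`0 < κ ≤ 1`)** — NODE 109's late functional with its threshold ANY FIXED FRACTION of the Thouless
horizon is a residual: every lag below `κ(c/2)N²` is free. [this cell] -/
theorem boundedResponse_of_subdiffusiveBondHeat_thoulessLateFloor {κ : ℝ} (hκ : 0 < κ) (hκ1 : κ ≤ 1) (hS : SubdiffusiveBondHeat)
    (hF : ThoulessLateFloor κ 1) : BoundedResponse :=
  boundedResponse_of_bathHeatWindow_thoulessLateFloor hκ hκ1 (bathHeatWindow_one_of_subdiffusiveBondHeat hS) hF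

/-- ★★★ **THE LOW-OCTAVE DOOR: (BHᵂ₁) ∧ (OR♭₁) ⟹ 11071** — the octave inequality at `t = c₁N²`, `c₁ = min(c, c₀)/2` (`c` the window constant,
`c₀` the residual's): `𝒲_N(2c₁N²) ≤ CN` because `2c₁ ≤ c`, and the octave `[c₁N², 2c₁N²]` is low enough for the residual. [this cell] -/
theorem boundedResponse_of_bathHeatWindow_lowOctaveReturnFloor (hW : BathHeatWindow 1) (hF : LowOctaveReturnFloor 1) : BoundedResponse := by
  refine ohmicFloor_iff_boundedResponse.1 fun ω₂ lam β γ hω hl hβ hγ T hT => ?_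
  obtain ⟨C, c, hc, N₀, hCN⟩ := hW ω₂ lam β γ hω hl hβ hγ T hT
  obtain ⟨c₀, hc₀, hF'⟩ := hF ω₂ lam β γ hω hl hβ hγ T hT
  have hm : 0 < min c c₀ := lt_min hc hc₀
  have hc₁ : 0 < min c c₀ / 2 := by positivity
  obtain ⟨C', N₁, hC'⟩ := hF' (min c c₀ / 2) hc₁ (by linarith [min_le_right c c₀])
  refine ⟨(C / 2 + C') / (min c c₀ / 2 * (γ * T ^ 2)), max N₀ (max N₁ 2), fun N hN => ?_⟩
  have hNN₀ : N₀ ≤ N := le_trans (le_max_left _ _) hN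
  have hNN₁ : N₁ ≤ N := le_trans (le_trans (le_max_left _ _) (le_max_right _ _)) hN
  have hN2 : 2 ≤ N := le_trans (le_trans (le_max_right _ _) (le_max_right _ _)) hN
  have hNpos : (0 : ℝ) < N := by exact_mod_cast (show 0 < N by omega)
  have hN2r : (0 : ℝ) ≤ (N : ℝ) ^ 2 := sq_nonneg _
  have ht0 : (0 : ℝ) ≤ min c c₀ / 2 * (N : ℝ) ^ 2 := by positivity
  have h2t : 2 * (min c c₀ / 2 * (N : ℝ) ^ 2) ≤ c * (N : ℝ) ^ 2 := by nlinarith [min_le_left c c₀]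
  have hW2 := hCN N hNN₀ _ ⟨by positivity, h2t⟩
  have hB := hC' N hNN₁
  rw [Real.rpow_one] at hW2 hB
  have h := mul_escapeDeficit_le_of_octave hω hl hβ hγ hT (show 1 < N by omega) ht0
  have hcγ : 0 < min c c₀ / 2 * (γ * T ^ 2) := by positivity
  rw [le_div_iff₀ hNpos, le_div_iff₀ hcγ]
  have h4 : (N : ℝ) * (escapeDeficit ω₂ lam β γ T N * N * (min c c₀ / 2 * (γ * T ^ 2))) ≤ N * (C / 2 + C') := by
    have e : (N : ℝ) * (escapeDeficit ω₂ lam β γ T N * N * (min c c₀ / 2 * (γ * T ^ 2))) =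
        min c c₀ / 2 * (N : ℝ) ^ 2 * (γ * T ^ 2 * escapeDeficit ω₂ lam β γ T N) := by ring
    rw [e]
    nlinarith
  exact le_of_mul_le_mul_left h4 hNpos

/-- ★★★ **BENEATH (S): (S) ∧ (OR♭₁) ⟹ 11071** — the weakest residual of the lineage: a floor on the octave increment of the bath tail functional
across SOME (every sufficiently low) Thouless octave. [this cell] -/
theorem boundedResponse_of_subdiffusiveBondHeat_lowOctaveReturnFloor (hS : SubdiffusiveBondHeat) (hF : LowOctaveReturnFloor 1) :
    BoundedResponse :=
  boundedResponse_of_bathHeatWindow_lowOctaveReturnFloor (bathHeatWindow_one_of_subdiffusiveBondHeat hS) hF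

/-- `(TL_{1/2,g}) ⟺ (OR_g)` (`B^late_N(t/2,t) = 2(B_N(t) − B_N(t/2))`, `c ↔ c/2`). [formal bookkeeping] -/
theorem thoulessLateFloor_half_iff_octaveReturnFloor {g : ℝ} : ThoulessLateFloor (1 / 2) g ↔ OctaveReturnFloor g := by
  constructor
  · intro h ω₂ lam β γ hω hl hβ hγ T hT c hc
    obtain ⟨C, N₀, hC⟩ := h ω₂ lam β γ hω hl hβ hγ T hT (2 * c) (by positivity)
    refine ⟨C / 2, N₀, fun N hN => ?_⟩
    have h1 := hC N hN
    have e : bathTailLate ω₂ lam β γ T N (1 / 2 * (2 * c * (N : ℝ) ^ 2)) (2 * c * (N : ℝ) ^ 2) =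
        2 * (bathTail ω₂ lam β γ T N (2 * (c * (N : ℝ) ^ 2)) - bathTail ω₂ lam β γ T N (c * (N : ℝ) ^ 2)) := by
      rw [show (1 : ℝ) / 2 * (2 * c * (N : ℝ) ^ 2) = 2 * (c * (N : ℝ) ^ 2) / 2 by ring,
        show (2 : ℝ) * c * (N : ℝ) ^ 2 = 2 * (c * (N : ℝ) ^ 2) by ring, bathTailLate_half,
        show (2 : ℝ) * (c * (N : ℝ) ^ 2) / 2 = c * (N : ℝ) ^ 2 by ring]
    rw [e] at h1
    have : -(C / 2 * (N : ℝ) ^ g) = -(C * (N : ℝ) ^ g) / 2 := by ring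
    rw [this]
    linarith
  · intro h ω₂ lam β γ hω hl hβ hγ T hT c hc
    obtain ⟨C, N₀, hC⟩ := h ω₂ lam β γ hω hl hβ hγ T hT (c / 2) (by positivity)
    refine ⟨2 * C, N₀, fun N hN => ?_⟩
    have h1 := hC N hN
    have e : bathTailLate ω₂ lam β γ T N (1 / 2 * (c * (N : ℝ) ^ 2)) (c * (N : ℝ) ^ 2) =
        2 * (bathTail ω₂ lam β γ T N (c * (N : ℝ) ^ 2) - bathTail ω₂ lam β γ T N (c / 2 * (N : ℝ) ^ 2)) := by
      rw [show (1 : ℝ) / 2 * (c * (N : ℝ) ^ 2) = c * (N : ℝ) ^ 2 / 2 by ring, bathTailLate_half,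
        show c * (N : ℝ) ^ 2 / 2 = c / 2 * (N : ℝ) ^ 2 by ring]
    rw [e, show (2 : ℝ) * (c / 2 * (N : ℝ) ^ 2) = c * (N : ℝ) ^ 2 by ring] at *
    have : -(2 * C * (N : ℝ) ^ g) = 2 * -(C * (N : ℝ) ^ g) := by ring
    rw [this]
    linarith

/-! ## §5 Necessity: (OR₁), (TL_{κ,1}) given Ohm modulo the ceiling (BTᶜ₁); ★ (OR♭₁) given Ohm beneath the window — exactness beneath (S) -/

/-- **(BT_g) ∧ (BTᶜ_g) ⟹ (OR_g)** (floor at `2c`, ceiling at `c`). [formal bookkeeping] -/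
theorem octaveReturnFloor_of_bathTailFloor_bathTailCeiling {g : ℝ} (hF : BathTailFloor g) (hC : BathTailCeiling g) : OctaveReturnFloor g := by
  intro ω₂ lam β γ hω hl hβ hγ T hT c hc
  obtain ⟨C₁, N₁, hC₁⟩ := hF ω₂ lam β γ hω hl hβ hγ T hT (2 * c) (by positivity)
  obtain ⟨C₂, N₂, hC₂⟩ := hC ω₂ lam β γ hω hl hβ hγ T hT c hc
  refine ⟨C₁ + C₂, max N₁ N₂, fun N hN => ?_⟩
  have h1 := hC₁ N (le_trans (le_max_left _ _) hN)
  have h2 := hC₂ N (le_trans (le_max_right _ _) hN)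
  rw [show (2 : ℝ) * c * (N : ℝ) ^ 2 = 2 * (c * (N : ℝ) ^ 2) by ring] at h1
  nlinarith [Real.rpow_nonneg (Nat.cast_nonneg N) g]

/-- ★ **NECESSITY MOD THE CEILING: Ohm ∧ (BTᶜ₁) ⟹ (OR₁)** (`B_N(2cN²) ≥ −2cN²·γT²E_N ≥ −C·N` given Ohm; `B_N(cN²) ≤ C·N` by the ceiling (BTᶜ₁),
which asks `O(N)` at EVERY Thouless multiple `c` and is NOT known beneath (S) — (S) bounds the window `t ≤ cN²` for ONE `c`; the low-octave form
(OR♭₁) below removes this proviso). [this cell] -/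
theorem octaveReturnFloor_of_boundedResponse_bathTailCeiling (hB : BoundedResponse) (hC : BathTailCeiling 1) : OctaveReturnFloor 1 :=
  octaveReturnFloor_of_bathTailFloor_bathTailCeiling (bathTailFloor_one_of_boundedResponse hB) hC

section Pos

variable (hω : 0 < ω₂) (hl : 0 < lam) (hβ : 0 < β) (hγ : 0 < γ) (hT : 0 < T)
include hω hl hβ hγ hT

/-- The octave increment at one `N ≥ 2` under a response bound and a variance bound: `E_N ≤ C₁/N` and `𝒲_N(t) ≤ W` give
`B_N(2t) − B_N(t) ≥ −(2t·γT²·C₁/N + W/2)` (`B_N(2t) ≥ −2t·γT²E_N`, `B_N(t) ≤ 𝒲_N(t)/2`). [formal bookkeeping] -/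
theorem bathTail_octave_ge_of_escapeDeficit_le {N : ℕ} (hN : 1 < N) {t C₁ W : ℝ} (ht : 0 ≤ t)
    (hE : escapeDeficit ω₂ lam β γ T N ≤ C₁ / N) (hW : bathHeatVar ω₂ lam β γ T N t ≤ W) :
    -(2 * t * (γ * T ^ 2) * C₁ / N + W / 2) ≤ bathTail ω₂ lam β γ T N (2 * t) - bathTail ω₂ lam β γ T N t := by
  have hNpos : (0 : ℝ) < N := by exact_mod_cast (show 0 < N by omega)
  have h1 := (neg_mul_escapeDeficit_le_bathTail hω hl hβ hγ hT hN (t := 2 * t) (by positivity)).1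
  have h2 := bathTail_le hω hl hβ hγ hT hN ht
  have h3 : 2 * t * (γ * T ^ 2 * escapeDeficit ω₂ lam β γ T N) ≤ 2 * t * (γ * T ^ 2) * C₁ / N := by
    have hk : 0 ≤ 2 * t * (γ * T ^ 2) := by positivity
    have h4 := mul_le_mul_of_nonneg_left hE hk
    calc 2 * t * (γ * T ^ 2 * escapeDeficit ω₂ lam β γ T N) = 2 * t * (γ * T ^ 2) * escapeDeficit ω₂ lam β γ T N := by ring
      _ ≤ 2 * t * (γ * T ^ 2) * (C₁ / N) := h4
      _ = 2 * t * (γ * T ^ 2) * C₁ / N := by ring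
  linarith

end Pos

/-- ★★ **EXACT NECESSITY BENEATH THE WINDOW: Ohm ∧ (BHᵂ₁) ⟹ (OR♭₁)** (`c₀ :=` the window constant: for `c ≤ c₀`, `B_N(cN²) ≤ 𝒲_N(cN²)/2 ≤ CN/2`
is FREE, and `B_N(2cN²) ≥ −2cN²·γT²E_N ≥ −2cγT²C₁·N` by Ohm).  No ceiling hypothesis (BTᶜ₁) is needed — unlike for (OR₁) and for NODE 109's
`LateTailFloor`. [this cell] -/
theorem lowOctaveReturnFloor_of_boundedResponse_bathHeatWindow (hB : BoundedResponse) (hW : BathHeatWindow 1) : LowOctaveReturnFloor 1 := by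
  intro ω₂ lam β γ hω hl hβ hγ T hT
  obtain ⟨C, c, hc, N₀, hCN⟩ := hW ω₂ lam β γ hω hl hβ hγ T hT
  obtain ⟨C₁, N₁, hC₁⟩ := (ohmicFloor_iff_boundedResponse.2 hB) ω₂ lam β γ hω hl hβ hγ T hT
  refine ⟨c, hc, fun c' hc' hc'c => ⟨2 * c' * (γ * T ^ 2) * C₁ + C / 2, max N₀ (max N₁ 2), fun N hN => ?_⟩⟩
  have hNN₀ : N₀ ≤ N := le_trans (le_max_left _ _) hN
  have hNN₁ : N₁ ≤ N := le_trans (le_trans (le_max_left _ _) (le_max_right _ _)) hN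
  have hN2 : 2 ≤ N := le_trans (le_trans (le_max_right _ _) (le_max_right _ _)) hN
  have hNpos : (0 : ℝ) < N := by exact_mod_cast (show 0 < N by omega)
  have hN2r : (0 : ℝ) ≤ (N : ℝ) ^ 2 := sq_nonneg _
  have ht0 : (0 : ℝ) ≤ c' * (N : ℝ) ^ 2 := by positivity
  have htc : c' * (N : ℝ) ^ 2 ≤ c * (N : ℝ) ^ 2 := by nlinarith
  have hWt := hCN N hNN₀ _ ⟨ht0, htc⟩
  rw [Real.rpow_one] at hWt
  have h := bathTail_octave_ge_of_escapeDeficit_le hω hl hβ hγ hT (show 1 < N by omega) ht0 (hC₁ N hNN₁) hWt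
  rw [Real.rpow_one]
  have e : 2 * (c' * (N : ℝ) ^ 2) * (γ * T ^ 2) * C₁ / N = 2 * c' * (γ * T ^ 2) * C₁ * N := by
    field_simp
  rw [e] at h
  nlinarith

/-- ★★★ **THE RESIDUAL IS EXACT: beneath (S), `11071 ⟺ (OR♭₁)`** — the low-octave return floor loses nothing of the blocker and adds nothing to it;
every supplier below is therefore a genuine sufficient condition and every refutation of (OR♭₁) refutes 11071 ∧ (S). [this cell] -/
theorem boundedResponse_iff_lowOctaveReturnFloor_of_subdiffusiveBondHeat (hS : SubdiffusiveBondHeat) :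
    BoundedResponse ↔ LowOctaveReturnFloor 1 :=
  ⟨fun hB => lowOctaveReturnFloor_of_boundedResponse_bathHeatWindow hB (bathHeatWindow_one_of_subdiffusiveBondHeat hS),
    boundedResponse_of_subdiffusiveBondHeat_lowOctaveReturnFloor hS⟩

/-- **(BT_g) ∧ (BTᶜ_g) ⟹ (TL_{κ,g})** (`κ > 0`; floor at `c` and `2κc`, ceiling at `κc`). [formal bookkeeping] -/
theorem thoulessLateFloor_of_bathTailFloor_bathTailCeiling {κ g : ℝ} (hκ : 0 < κ) (hF : BathTailFloor g) (hC : BathTailCeiling g) :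
    ThoulessLateFloor κ g := by
  intro ω₂ lam β γ hω hl hβ hγ T hT c hc
  obtain ⟨C₁, N₁, hC₁⟩ := hF ω₂ lam β γ hω hl hβ hγ T hT c hc
  obtain ⟨C₂, N₂, hC₂⟩ := hF ω₂ lam β γ hω hl hβ hγ T hT (2 * κ * c) (by positivity)
  obtain ⟨C₃, N₃, hC₃⟩ := hC ω₂ lam β γ hω hl hβ hγ T hT (κ * c) (by positivity)
  refine ⟨C₁ + C₂ + 2 * C₃, max N₁ (max N₂ N₃), fun N hN => ?_⟩
  have h1 := hC₁ N (le_trans (le_max_left _ _) hN)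
  have h2 := hC₂ N (le_trans (le_trans (le_max_left _ _) (le_max_right _ _)) hN)
  have h3 := hC₃ N (le_trans (le_trans (le_max_right _ _) (le_max_right _ _)) hN)
  rw [show (2 : ℝ) * κ * c * (N : ℝ) ^ 2 = 2 * (κ * (c * (N : ℝ) ^ 2)) by ring] at h2
  rw [show κ * c * (N : ℝ) ^ 2 = κ * (c * (N : ℝ) ^ 2) by ring] at h3
  unfold bathTailLate bathTailEarly
  nlinarith [Real.rpow_nonneg (Nat.cast_nonneg N) g]

/-- **Ohm ∧ (BTᶜ₁) ⟹ (TL_{κ,1})** (`κ > 0`). [formal bookkeeping] -/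
theorem thoulessLateFloor_of_boundedResponse_bathTailCeiling {κ : ℝ} (hκ : 0 < κ) (hB : BoundedResponse) (hC : BathTailCeiling 1) :
    ThoulessLateFloor κ 1 :=
  thoulessLateFloor_of_bathTailFloor_bathTailCeiling hκ (bathTailFloor_one_of_boundedResponse hB) hC

/-! ## §6 Suppliers I: the kernel-level hub (TNM) ⟹ (OR₁), fed by NODE 109's (LNM_a) and NODE 117's (BNM_I) -/

section Pos

variable (hω : 0 < ω₂) (hl : 0 < lam) (hβ : 0 < β) (hγ : 0 < γ) (hT : 0 < T)
include hω hl hβ hγ hT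

/-- Lower bound of the octave increment by a constant lower bound of the owed heat on the octave: `𝒯_N ≥ −L` on `[t, 2t]` (`t ≥ 0`) ⟹
`B_N(2t) − B_N(t) ≥ −γ²·t·L`. [formal bookkeeping] -/
theorem bathTail_octave_ge_of_owedHeat_ge (N : ℕ) {t L : ℝ} (ht : 0 ≤ t)
    (hL : ∀ v ∈ Icc t (2 * t), -L ≤ owedHeat ω₂ lam β γ T N v) :
    -(γ ^ 2 * (t * L)) ≤ bathTail ω₂ lam β γ T N (2 * t) - bathTail ω₂ lam β γ T N t := by
  have ht2 : t ≤ 2 * t := by linarith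
  rw [bathTail_octave_eq_owedHeat hω hl hβ hγ hT N ht]
  have hI := (intervalIntegrable_owedHeat hω hl hβ hγ hT N ht ht2).1
  have hmono := intervalIntegral.integral_mono_on ht2 intervalIntegrable_const hI hL
  rw [intervalIntegral.integral_const, smul_eq_mul] at hmono
  have e : -(γ ^ 2 * (t * L)) = γ ^ 2 * ((2 * t - t) * -L) := by ring
  rw [e]
  exact mul_le_mul_of_nonneg_left hmono (sq_nonneg γ)

/-- The owed heat past a lag `v ≥ v₀ ≥ 0` is at least minus the negative kernel mass beyond `v₀`: `𝒯_N(v) ≥ −∫_{(v₀,∞)} K_N⁻`. [formal bookkeeping] -/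
theorem owedHeat_ge_neg_negMass (N : ℕ) {v₀ v : ℝ} (hv₀ : 0 ≤ v₀) (hv : v₀ ≤ v) :
    -(∫ r in Ioi v₀, max (-(bathKinCorr ω₂ lam β γ T N r)) 0) ≤ owedHeat ω₂ lam β γ T N v := by
  have hKm0 := integrableOn_negPart_bathKinCorr hω hl hβ hγ hT N
  have hKm₀ : IntegrableOn (fun r : ℝ => max (-(bathKinCorr ω₂ lam β γ T N r)) 0) (Ioi v₀) := hKm0.mono_set (Ioi_subset_Ioi hv₀)
  have hKmv : IntegrableOn (fun r : ℝ => max (-(bathKinCorr ω₂ lam β γ T N r)) 0) (Ioi v) := hKm0.mono_set (Ioi_subset_Ioi (hv₀.trans hv))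
  have hKv : IntegrableOn (bathKinCorr ω₂ lam β γ T N) (Ioi v) :=
    (bathKinCorr_measurable_integrableOn hω hl hβ hγ hT N).2.mono_set (Ioi_subset_Ioi (hv₀.trans hv))
  have h1 : ∫ r in Ioi v, -max (-(bathKinCorr ω₂ lam β γ T N r)) 0 ≤ ∫ r in Ioi v, bathKinCorr ω₂ lam β γ T N r :=
    setIntegral_mono hKmv.neg hKv fun r => by
      simp only
      have := le_max_left (-(bathKinCorr ω₂ lam β γ T N r)) 0
      linarith
  have h2 : ∫ r in Ioi v, max (-(bathKinCorr ω₂ lam β γ T N r)) 0 ≤ ∫ r in Ioi v₀, max (-(bathKinCorr ω₂ lam β γ T N r)) 0 :=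
    setIntegral_mono_set hKm₀ (ae_of_all _ fun r => le_max_right _ _) (ae_of_all _ (Ioi_subset_Ioi hv))
  rw [integral_neg] at h1
  unfold owedHeat
  linarith

end Pos

/-- ★ **(TNM) ⟹ (OR₁)**: `𝒯_N ≥ −∫_{(cN²,∞)}K_N⁻` on the octave, so `B_N(2cN²) − B_N(cN²) ≥ −γ²cN²·∫_{(cN²,∞)}K_N⁻ ≥ −cγT²C·N`. [this cell] -/
theorem octaveReturnFloor_of_thoulessNegMass (h : ThoulessNegMass) : OctaveReturnFloor 1 := by
  intro ω₂ lam β γ hω hl hβ hγ T hT c hc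
  obtain ⟨C, N₀, hC⟩ := h ω₂ lam β γ hω hl hβ hγ T hT c hc
  refine ⟨c * (γ * T ^ 2) * max C 0, max N₀ 1, fun N hN => ?_⟩
  have hNN₀ : N₀ ≤ N := le_trans (le_max_left _ _) hN
  have hN1 : 1 ≤ N := le_trans (le_max_right _ _) hN
  have hNpos : (0 : ℝ) < N := by exact_mod_cast (show 0 < N by omega)
  have ht0 : (0 : ℝ) ≤ c * (N : ℝ) ^ 2 := by positivity
  set M := ∫ r in Ioi (c * (N : ℝ) ^ 2), max (-(bathKinCorr ω₂ lam β γ T N r)) 0 with hM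
  have hMC := hC N hNN₀
  have h1 := bathTail_octave_ge_of_owedHeat_ge hω hl hβ hγ hT N ht0 (L := M)
    (fun v hv => owedHeat_ge_neg_negMass hω hl hβ hγ hT N ht0 hv.1)
  rw [Real.rpow_one]
  -- γ²·cN²·M = c γ T² N · (γ/T²·M)·N ≤ c γ T² · max C 0 · N
  have h2 : γ / T ^ 2 * M * N ≤ max C 0 := by
    have := hMC.trans (div_le_div_of_nonneg_right (le_max_left C 0) hNpos.le)
    rwa [le_div_iff₀ hNpos] at this
  have e : γ ^ 2 * (c * (N : ℝ) ^ 2 * M) = c * (γ * T ^ 2) * N * (γ / T ^ 2 * M * N) := by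
    field_simp
  rw [e] at h1
  have h3 : c * (γ * T ^ 2) * N * (γ / T ^ 2 * M * N) ≤ c * (γ * T ^ 2) * N * max C 0 :=
    mul_le_mul_of_nonneg_left h2 (by positivity)
  linarith

/-- ★ **(S) ∧ (TNM) ⟹ 11071.** [this cell] -/
theorem boundedResponse_of_subdiffusiveBondHeat_thoulessNegMass (hS : SubdiffusiveBondHeat) (h : ThoulessNegMass) : BoundedResponse :=
  boundedResponse_of_subdiffusiveBondHeat_octaveReturnFloor hS (octaveReturnFloor_of_thoulessNegMass h)

/-- ★ **`LateNegMass a ⟹ (TNM)`** (`a ≥ 0`): beyond the horizon the weight `min(r, cN²)` equals `cN²`, so `cN²·∫_{(cN²,∞)}K_N⁻ ≤ 𝔐_N(aN, cN²)`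
once `aN ≤ cN²`.  NODE 109's weakest supplier feeds this node's; the converse fails (negative mass at `N ≪ r ≪ N²`). [this cell] -/
theorem thoulessNegMass_of_lateNegMass {a : ℝ} (ha : 0 ≤ a) (hM : LateNegMass a) : ThoulessNegMass := by
  intro ω₂ lam β γ hω hl hβ hγ T hT c hc
  obtain ⟨C, N₀, hC⟩ := hM ω₂ lam β γ hω hl hβ hγ T hT c hc
  obtain ⟨N₁, hN₁⟩ := eventually_lateWindow (a := a) (q := 1) hc N₀
  refine ⟨max C 0 / (c * γ * T ^ 2), N₁, fun N hN => ?_⟩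
  obtain ⟨hNN₀, hN1, hw⟩ := hN₁ N hN
  have hNpos : (0 : ℝ) < N := by exact_mod_cast (show 0 < N by omega)
  have ht : (0 : ℝ) < c * (N : ℝ) ^ 2 := by positivity
  have hs : (0 : ℝ) ≤ a * N := by positivity
  have hst : a * (N : ℝ) ≤ c * (N : ℝ) ^ 2 := by linarith
  set t := c * (N : ℝ) ^ 2 with htdef
  have hKm0 := integrableOn_negPart_bathKinCorr hω hl hβ hγ hT N
  have hint := integrableOn_min_mul_negPart hω hl hβ hγ hT (show 0 < N by omega) hs ht.le
  -- t·∫_{Ioi t} K⁻ = ∫_{Ioi t} min(r,t) K⁻ ≤ ∫_{Ioi (aN)} min(r,t) K⁻ = 𝔐_N(aN, t)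
  have h1 : ∫ r in Ioi t, min r t * max (-(bathKinCorr ω₂ lam β γ T N r)) 0 =
      t * ∫ r in Ioi t, max (-(bathKinCorr ω₂ lam β γ T N r)) 0 := by
    rw [← integral_const_mul]
    refine setIntegral_congr_fun measurableSet_Ioi fun r hr => ?_
    rw [min_eq_right (le_of_lt hr)]
  have h2 : ∫ r in Ioi t, min r t * max (-(bathKinCorr ω₂ lam β γ T N r)) 0 ≤ lateNegMass ω₂ lam β γ T N (a * N) t :=
    setIntegral_mono_set hint
      (by filter_upwards [ae_restrict_mem measurableSet_Ioi] with r hr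
          exact mul_nonneg (le_min (hs.trans (le_of_lt hr)) ht.le) (le_max_right _ _))
      (ae_of_all _ (Ioi_subset_Ioi hst))
  have h3 := hC N hNN₀
  -- (γ/T²)·∫ K⁻ = (γ² t ∫K⁻)/(γ T² t) ≤ C N/(γT² c N²) = (C/(cγT²))/N
  have h4 : γ ^ 2 * (t * ∫ r in Ioi t, max (-(bathKinCorr ω₂ lam β γ T N r)) 0) ≤ max C 0 * N := by
    rw [← h1]
    nlinarith [mul_le_mul_of_nonneg_left h2 (sq_nonneg γ), le_max_left C 0]
  have e : γ / T ^ 2 * (∫ r in Ioi t, max (-(bathKinCorr ω₂ lam β γ T N r)) 0) =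
      γ ^ 2 * (t * ∫ r in Ioi t, max (-(bathKinCorr ω₂ lam β γ T N r)) 0) / (γ * T ^ 2 * t) := by
    field_simp
  rw [e, div_le_div_iff₀ (by positivity) hNpos, htdef]
  have e2 : max C 0 / (c * γ * T ^ 2) * (γ * T ^ 2 * (c * (N : ℝ) ^ 2)) = max C 0 * N * N := by
    field_simp
  rw [e2]
  exact mul_le_mul_of_nonneg_right h4 hNpos.le

/-- ★ **`BandNegMass ⟹ (TNM)`**: beyond the horizon the band weight `min((r/t)²/2, 2)` is at least `1/2`, so `∫_{(cN²,∞)}K_N⁻ ≤ 2𝔔_N(cN²)`.  NODE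
117's weakest time-domain supplier feeds this node's; the converse fails (negative mass at `N ≪ r ≪ N²`). [this cell] -/
theorem thoulessNegMass_of_bandNegMass (hQ : BandNegMass) : ThoulessNegMass := by
  intro ω₂ lam β γ hω hl hβ hγ T hT c hc
  obtain ⟨C, N₀, hC⟩ := hQ ω₂ lam β γ hω hl hβ hγ T hT c hc
  refine ⟨2 * C, max N₀ 1, fun N hN => ?_⟩
  have hNN₀ : N₀ ≤ N := le_trans (le_max_left _ _) hN
  have hN1 : 1 ≤ N := le_trans (le_max_right _ _) hN
  have hNpos : (0 : ℝ) < N := by exact_mod_cast (show 0 < N by omega)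
  have ht : (0 : ℝ) < c * (N : ℝ) ^ 2 := by positivity
  set t := c * (N : ℝ) ^ 2 with htdef
  have hKm0 := integrableOn_negPart_bathKinCorr hω hl hβ hγ hT N
  have hw := integrableOn_bandWeight_mul_negPart hω hl hβ hγ hT N t
  -- (1/2)∫_{Ioi t}K⁻ ≤ ∫_{Ioi t} w K⁻ ≤ ∫_{Ioi 0} w K⁻ = 𝔔
  have h1 : ∫ r in Ioi t, (1 / 2 : ℝ) * max (-(bathKinCorr ω₂ lam β γ T N r)) 0 ≤
      ∫ r in Ioi t, min ((r / t) ^ 2 / 2) 2 * max (-(bathKinCorr ω₂ lam β γ T N r)) 0 := by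
    refine setIntegral_mono_on ((hKm0.mono_set (Ioi_subset_Ioi ht.le)).const_mul _) (hw.mono_set (Ioi_subset_Ioi ht.le))
      measurableSet_Ioi fun r hr => ?_
    refine mul_le_mul_of_nonneg_right (le_min ?_ (by norm_num)) (le_max_right _ _)
    have hrt : 1 ≤ r / t := by rw [le_div_iff₀ ht]; linarith [show t < r from hr]
    nlinarith
  have h2 : ∫ r in Ioi t, min ((r / t) ^ 2 / 2) 2 * max (-(bathKinCorr ω₂ lam β γ T N r)) 0 ≤ bandNegMass ω₂ lam β γ T N t :=
    setIntegral_mono_set hw (ae_of_all _ fun r => mul_nonneg (bandWeight_mem_Icc r t).1 (le_max_right _ _))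
      (ae_of_all _ (Ioi_subset_Ioi ht.le))
  rw [integral_const_mul] at h1
  have h3 := hC N hNN₀
  have hγT : 0 ≤ γ / T ^ 2 := by positivity
  calc γ / T ^ 2 * ∫ r in Ioi t, max (-(bathKinCorr ω₂ lam β γ T N r)) 0
      = 2 * (γ / T ^ 2 * ((1 / 2 : ℝ) * ∫ r in Ioi t, max (-(bathKinCorr ω₂ lam β γ T N r)) 0)) := by ring
    _ ≤ 2 * (γ / T ^ 2 * bandNegMass ω₂ lam β γ T N t) := by nlinarith [mul_le_mul_of_nonneg_left (h1.trans h2) hγT]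
    _ ≤ 2 * (C / N) := by linarith
    _ = 2 * C / N := by ring

end Chain

end Summit.AtomisticToContinuum.FouriersLaw.Theorems.BoundedResponse.HeatSpreading
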